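import Literature.AnabelianGeometry.SemiGraphs.SectionFibreGluing
import HarnessLib

/-!
# Section fibres along a restricted covering: the branch step of the sheet argument
# ([SemiAnbd] §2, proof of Cor. 2.7 (i) p. 30)

Mochizuki, *Semi-graphs of anabelioids*, Publ. RIMS **42** (2006), §2, proof of Cor. 2.7 (i) p. 30
("`ℋ′` injects into `𝒢′` as a subgraph") [cite: MochizukiSemiAnbd2006, Cor. 2.7(i) p.30]; Rem. 2.11.1
p. 32 (pull-back functors, re-indexing of edge components).  PROOF-ONLY (abc-iut cell, layer L3, gap row
G-L3-R1-E3 «(Surj) under branch alignment», abc-iut-L3-d3; part C of the sheet argument for section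
fibres).  Setting: `φ : 𝒢′ → 𝒢`, `A ∈ B(𝒢)`, `K ⊆ 𝔾′` over `ℍ ⊆ 𝔾`, `ψ := φ|_K`, a section
`s : T → φ^* A` (`T` with terminal constituents), `Y ∈ B(𝒢_ℍ)` with `f : Y → A|_ℍ`, a sub-object
`j : W ↪ ψ^* Y`; a branch `β` of `K` abutting to `ω ∈ K`, `c ↪ Y_u` and `d ↪ Y_e` under `c` along `φ β`.
* `Hom.reindexIso_hom_app_comp`, `Hom.sectionE_transport` — `s_{f′}`, re-indexed to the edge of `φ β`,
  IS the section transported from `s_ω` along `β`; `Hom.exists_point_pull_sectionFibre'` — part B's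
  gluing lemma for any edge section satisfying the transport identity;
* `Hom.sectionFibre_edge_meets_of_vertex_factors` — **vertex ⇒ edge**: if the section fibre `Ψ_c`
  factors through `W_ω`, then `W_{f′}` meets `Ψ_d`; `Hom.sectionFibre_vertex_factors_of_edge_meets` —
  **edge ⇒ vertex**: if `W_{f′}` meets `Ψ_d` and `c` is connected, `Ψ_c` factors through `W_ω`, GIVEN
  vertex alignment at the section point (`Stab(x_ω) ≤ ι_ω(Π_ω)`, Rem. 2.2.1).
No definition; nothing here takes a side on [IUTchIII] Cor. 3.12.
-/

namespace Literature.AnabelianGeometry.SemiGraphs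

open CategoryTheory CategoryTheory.Limits CategoryTheory.PreGaloisCategory
open Literature.AnabelianGeometry.Anabelioids

universe v₁ u₁ u

namespace SemiGraphOfAnabelioids

variable {𝒢 𝒢' : SemiGraphOfAnabelioids.{v₁, u₁, u}}

/-! ### Re-indexing and the transported edge section -/

/-- Re-indexing there and back is the identity. [cite: MochizukiSemiAnbd2006, Rem. 2.11.1 p.32] -/
theorem Hom.reindexIso_hom_app_comp (φ : Hom 𝒢' 𝒢) (e' : 𝒢'.graph.Edge) (g g' : 𝒢.graph.Edge)
    (p : φ.base.edgeMap e' = g) (p' : φ.base.edgeMap e' = g') (X : 𝒢.BObj) :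
    (φ.reindexIso e' g g' p p').hom.app X ≫ (φ.reindexIso e' g' g p' p).hom.app X = 𝟙 _ := by
  subst p; subst p'
  have h : φ.reindexIso e' (φ.base.edgeMap e') (φ.base.edgeMap e') rfl rfl = Iso.refl _ := rfl
  rw [h]
  simp

/-- **The edge constituent of a section is the transported vertex constituent.**  For a morphism
`s : T → φ^* A` of `B(𝒢′)` and a branch `β` abutting to `ω`: `s_{f′}` (re-indexed from the edge `φ f′`
to the edge of `φ β`) satisfies `T.ψ_β ≫ s_{f′} = β^* s_ω ≫ φ_β ≫ φ_{f′}^* ψ^A_{φ β}` — the compatibility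
of `s` with the gluings, with the gluing of `φ^* A` unfolded. [cite: MochizukiSemiAnbd2006, Rem. 2.11.1 p.32] -/
theorem Hom.sectionE_transport (φ : Hom 𝒢' 𝒢) (A : 𝒢.BObj) {T : 𝒢'.BObj}
    (s : T ⟶ φ.pullbackFunctor.obj A) (β : 𝒢'.graph.Branch) (ω : 𝒢'.graph.Vertex)
    (hβω : 𝒢'.graph.abuts β = some ω) :
    (T.ψ β ω hβω).hom ≫ s.fT (𝒢'.graph.edgeOf β) ≫
        (φ.reindexIso (𝒢'.graph.edgeOf β) (φ.base.edgeMap (𝒢'.graph.edgeOf β))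
          (𝒢.graph.edgeOf (φ.base.branchMap β)) rfl (φ.base.edgeOf_branchMap β).symm).hom.app A =
      (𝒢'.pull β ω hβω).pullback.map (s.fS ω) ≫ (φ.φB β ω hβω).hom.app (A.S (φ.base.vertexMap ω)) ≫
        (φ.φE (𝒢'.graph.edgeOf β) (𝒢.graph.edgeOf (φ.base.branchMap β))
            (φ.base.edgeOf_branchMap β).symm).pullback.map
          (A.ψ (φ.base.branchMap β) (φ.base.vertexMap ω) (φ.base.abuts_branchMap β ω hβω)).hom := by
  let Φω : 𝒢.V (φ.base.vertexMap ω) ⥤ 𝒢'.V ω := (φ.φV ω).pullback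
  let Φe : 𝒢.E (𝒢.graph.edgeOf (φ.base.branchMap β)) ⥤ 𝒢'.E (𝒢'.graph.edgeOf β) :=
    (φ.φE (𝒢'.graph.edgeOf β) (𝒢.graph.edgeOf (φ.base.branchMap β))
      (φ.base.edgeOf_branchMap β).symm).pullback
  let Φr : 𝒢.E (φ.base.edgeMap (𝒢'.graph.edgeOf β)) ⥤ 𝒢'.E (𝒢'.graph.edgeOf β) :=
    (φ.φE (𝒢'.graph.edgeOf β) (φ.base.edgeMap (𝒢'.graph.edgeOf β)) rfl).pullback
  let B : 𝒢'.V ω ⥤ 𝒢'.E (𝒢'.graph.edgeOf β) := (𝒢'.pull β ω hβω).pullback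
  let bY : 𝒢.V (φ.base.vertexMap ω) ⥤ 𝒢.E (𝒢.graph.edgeOf (φ.base.branchMap β)) :=
    (𝒢.pull (φ.base.branchMap β) (φ.base.vertexMap ω) (φ.base.abuts_branchMap β ω hβω)).pullback
  let φBh : B.obj (Φω.obj (A.S (φ.base.vertexMap ω))) ⟶ Φe.obj (bY.obj (A.S (φ.base.vertexMap ω))) :=
    (φ.φB β ω hβω).hom.app (A.S (φ.base.vertexMap ω))
  let Aψh : bY.obj (A.S (φ.base.vertexMap ω)) ⟶ A.T (𝒢.graph.edgeOf (φ.base.branchMap β)) :=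
    (A.ψ (φ.base.branchMap β) (φ.base.vertexMap ω) (φ.base.abuts_branchMap β ω hβω)).hom
  let R₁ : Φe.obj (A.T (𝒢.graph.edgeOf (φ.base.branchMap β))) ⟶
      Φr.obj (A.T (φ.base.edgeMap (𝒢'.graph.edgeOf β))) :=
    (φ.reindexIso (𝒢'.graph.edgeOf β) (𝒢.graph.edgeOf (φ.base.branchMap β))
      (φ.base.edgeMap (𝒢'.graph.edgeOf β)) (φ.base.edgeOf_branchMap β).symm rfl).hom.app A
  let R₂ : Φr.obj (A.T (φ.base.edgeMap (𝒢'.graph.edgeOf β))) ⟶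
      Φe.obj (A.T (𝒢.graph.edgeOf (φ.base.branchMap β))) :=
    (φ.reindexIso (𝒢'.graph.edgeOf β) (φ.base.edgeMap (𝒢'.graph.edgeOf β))
      (𝒢.graph.edgeOf (φ.base.branchMap β)) rfl (φ.base.edgeOf_branchMap β).symm).hom.app A
  let sω : T.S ω ⟶ Φω.obj (A.S (φ.base.vertexMap ω)) := s.fS ω
  let sf : T.T (𝒢'.graph.edgeOf β) ⟶ Φr.obj (A.T (φ.base.edgeMap (𝒢'.graph.edgeOf β))) :=
    s.fT (𝒢'.graph.edgeOf β)
  let Tψh : B.obj (T.S ω) ⟶ T.T (𝒢'.graph.edgeOf β) := (T.ψ β ω hβω).hom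
  have hc : B.map sω ≫ φBh ≫ Φe.map Aψh ≫ R₁ = Tψh ≫ sf := s.comm β ω hβω
  have hR : R₁ ≫ R₂ = 𝟙 _ := φ.reindexIso_hom_app_comp _ _ _ _ _ A
  show Tψh ≫ sf ≫ R₂ = B.map sω ≫ φBh ≫ Φe.map Aψh
  calc Tψh ≫ sf ≫ R₂ = (Tψh ≫ sf) ≫ R₂ := (Category.assoc _ _ _).symm
    _ = (B.map sω ≫ φBh ≫ Φe.map Aψh ≫ R₁) ≫ R₂ := by rw [hc]
    _ = B.map sω ≫ φBh ≫ Φe.map Aψh ≫ (R₁ ≫ R₂) := by simp only [Category.assoc]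
    _ = B.map sω ≫ φBh ≫ Φe.map Aψh := by rw [hR, Category.comp_id]

/-- Part B's gluing lemma for ANY edge section `σ : T_{f′} → φ_{f′}^* A_e` satisfying the transport
identity `T.ψ_β ≫ σ = β^* s_ω ≫ φ_β ≫ φ_{f′}^* ψ^A_{φ β}` (then `σ` IS the transported section).
[cite: MochizukiSemiAnbd2006, Cor. 2.7(i) p.30] -/
theorem Hom.exists_point_pull_sectionFibre' (φ : Hom 𝒢' 𝒢) (A : 𝒢.BObj) (H : 𝒢.graph.Subgraph)
    (T : 𝒢'.BObj) (hTV : ∀ v', IsTerminal (T.S v')) (hTE : ∀ e', IsTerminal (T.T e'))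
    (s : T ⟶ φ.pullbackFunctor.obj A)
    (β : 𝒢'.graph.Branch) (ω : 𝒢'.graph.Vertex) (hβω : 𝒢'.graph.abuts β = some ω)
    (huH : φ.base.vertexMap ω ∈ H.verts) (heH : 𝒢.graph.edgeOf (φ.base.branchMap β) ∈ H.edges)
    (Y : (𝒢.restrict H).BObj) (f : Y ⟶ (𝒢.restrictFunctor H).obj A)
    {c : 𝒢.V (φ.base.vertexMap ω)} (ιc : c ⟶ Y.S ⟨φ.base.vertexMap ω, huH⟩)
    {d : 𝒢.E (𝒢.graph.edgeOf (φ.base.branchMap β))}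
    (ιd : d ⟶ Y.T ⟨𝒢.graph.edgeOf (φ.base.branchMap β), heH⟩)
    (k : d ⟶ (𝒢.pull (φ.base.branchMap β) (φ.base.vertexMap ω)
      (φ.base.abuts_branchMap β ω hβω)).pullback.obj c)
    (hk : k ≫ (𝒢.pull (φ.base.branchMap β) (φ.base.vertexMap ω)
        (φ.base.abuts_branchMap β ω hβω)).pullback.map ιc ≫
      (Y.ψ ⟨φ.base.branchMap β, heH⟩ ⟨φ.base.vertexMap ω, huH⟩
        ((SemiGraph.Subgraph.abuts_eq_some_iff H _ _).mpr (φ.base.abuts_branchMap β ω hβω))).hom = ιd)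
    (σ : T.T (𝒢'.graph.edgeOf β) ⟶
      (φ.φE (𝒢'.graph.edgeOf β) (𝒢.graph.edgeOf (φ.base.branchMap β))
        (φ.base.edgeOf_branchMap β).symm).pullback.obj (A.T (𝒢.graph.edgeOf (φ.base.branchMap β))))
    (hσ : (T.ψ β ω hβω).hom ≫ σ =
      (𝒢'.pull β ω hβω).pullback.map (s.fS ω) ≫ (φ.φB β ω hβω).hom.app (A.S (φ.base.vertexMap ω)) ≫
        (φ.φE (𝒢'.graph.edgeOf β) (𝒢.graph.edgeOf (φ.base.branchMap β))
            (φ.base.edgeOf_branchMap β).symm).pullback.map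
          (A.ψ (φ.base.branchMap β) (φ.base.vertexMap ω) (φ.base.abuts_branchMap β ω hβω)).hom)
    (Fe : 𝒢'.E (𝒢'.graph.edgeOf β) ⥤ FintypeCat.{v₁}) [FiberFunctor Fe]
    (π : Fe.obj (pullback
      ((φ.φE (𝒢'.graph.edgeOf β) (𝒢.graph.edgeOf (φ.base.branchMap β))
          (φ.base.edgeOf_branchMap β).symm).pullback.map
        (ιd ≫ f.fT ⟨𝒢.graph.edgeOf (φ.base.branchMap β), heH⟩)) σ)) :
    ∃ ρ : Fe.obj ((𝒢'.pull β ω hβω).pullback.obj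
        (pullback ((φ.φV ω).pullback.map (ιc ≫ f.fS ⟨φ.base.vertexMap ω, huH⟩)) (s.fS ω))),
      Fe.map ((𝒢'.pull β ω hβω).pullback.map
          (pullback.fst ((φ.φV ω).pullback.map (ιc ≫ f.fS ⟨φ.base.vertexMap ω, huH⟩)) (s.fS ω) ≫
            (φ.φV ω).pullback.map ιc) ≫
        (φ.φB β ω hβω).hom.app (Y.S ⟨φ.base.vertexMap ω, huH⟩) ≫
        (φ.φE (𝒢'.graph.edgeOf β) (𝒢.graph.edgeOf (φ.base.branchMap β))
            (φ.base.edgeOf_branchMap β).symm).pullback.map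
          (Y.ψ ⟨φ.base.branchMap β, heH⟩ ⟨φ.base.vertexMap ω, huH⟩
            ((SemiGraph.Subgraph.abuts_eq_some_iff H _ _).mpr (φ.base.abuts_branchMap β ω hβω))).hom) ρ =
      Fe.map (pullback.fst _ _ ≫
        (φ.φE (𝒢'.graph.edgeOf β) (𝒢.graph.edgeOf (φ.base.branchMap β))
          (φ.base.edgeOf_branchMap β).symm).pullback.map ιd) π := by
  have hσ' : σ = (T.ψ β ω hβω).inv ≫
      (𝒢'.pull β ω hβω).pullback.map (s.fS ω) ≫ (φ.φB β ω hβω).hom.app (A.S (φ.base.vertexMap ω)) ≫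
        (φ.φE (𝒢'.graph.edgeOf β) (𝒢.graph.edgeOf (φ.base.branchMap β))
            (φ.base.edgeOf_branchMap β).symm).pullback.map
          (A.ψ (φ.base.branchMap β) (φ.base.vertexMap ω) (φ.base.abuts_branchMap β ω hβω)).hom := by
    rw [← hσ, Iso.inv_hom_id_assoc]
  subst hσ'
  exact φ.exists_point_pull_sectionFibre A H T hTV hTE s β ω hβω huH heH Y f ιc ιd k hk Fe π

/-! ### The branch step: vertex ⇒ edge -/

/-- **Vertex ⇒ edge.**  In the setting of the module docstring (`ψ = φ|_K`, `j : W ↪ ψ^* Y`, a branch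
`β` of `K` abutting to `ω ∈ K`, `d` under `c` along `φ β`): if the section fibre
`Ψ_c → φ_ω^* Y_u` factors through `j_ω`, then for every point `π` of the edge section fibre `Ψ_d`
(edge section `s_{f′}` re-indexed to the edge of `φ β`) there is a point `ϖ` of `F(W_{f′})` with
`F(j_{f′})(ϖ) = F(Ψ_d → φ_{f′}^* Y_e)(π)` (re-indexed) — `W_{f′}` MEETS `Ψ_d`.  (Part B along the
gluing of `W`.) [cite: MochizukiSemiAnbd2006, Cor. 2.7(i) p.30] -/
theorem Hom.sectionFibre_edge_meets_of_vertex_factors (φ : Hom 𝒢' 𝒢) (A : 𝒢.BObj)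
    (H : 𝒢.graph.Subgraph) (K : 𝒢'.graph.Subgraph)
    (hKV : K.verts ⊆ φ.base.vertexMap ⁻¹' H.verts) (hKE : K.edges ⊆ φ.base.edgeMap ⁻¹' H.edges)
    (T : 𝒢'.BObj) (hTV : ∀ v', IsTerminal (T.S v')) (hTE : ∀ e', IsTerminal (T.T e'))
    (s : T ⟶ φ.pullbackFunctor.obj A)
    (β : 𝒢'.graph.Branch) (ω : 𝒢'.graph.Vertex) (hβω : 𝒢'.graph.abuts β = some ω)
    (hωK : ω ∈ K.verts) (hfK : 𝒢'.graph.edgeOf β ∈ K.edges)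
    (heH : 𝒢.graph.edgeOf (φ.base.branchMap β) ∈ H.edges)
    (Y : (𝒢.restrict H).BObj) (f : Y ⟶ (𝒢.restrictFunctor H).obj A)
    {W : (𝒢'.restrict K).BObj} (j : W ⟶ (φ.restrict K H hKV hKE).pullbackFunctor.obj Y) [Mono j]
    {c : 𝒢.V (φ.base.vertexMap ω)} (ιc : c ⟶ Y.S ⟨φ.base.vertexMap ω, hKV hωK⟩)
    {d : 𝒢.E (𝒢.graph.edgeOf (φ.base.branchMap β))}
    (ιd : d ⟶ Y.T ⟨𝒢.graph.edgeOf (φ.base.branchMap β), heH⟩)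
    (k : d ⟶ (𝒢.pull (φ.base.branchMap β) (φ.base.vertexMap ω)
      (φ.base.abuts_branchMap β ω hβω)).pullback.obj c)
    (hk : k ≫ (𝒢.pull (φ.base.branchMap β) (φ.base.vertexMap ω)
        (φ.base.abuts_branchMap β ω hβω)).pullback.map ιc ≫
      (Y.ψ ⟨φ.base.branchMap β, heH⟩ ⟨φ.base.vertexMap ω, hKV hωK⟩
        ((SemiGraph.Subgraph.abuts_eq_some_iff H _ _).mpr (φ.base.abuts_branchMap β ω hβω))).hom = ιd)
    (g : pullback ((φ.φV ω).pullback.map (ιc ≫ f.fS ⟨φ.base.vertexMap ω, hKV hωK⟩)) (s.fS ω) ⟶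
      W.S ⟨ω, hωK⟩)
    (hg : g ≫ j.fS ⟨ω, hωK⟩ =
      pullback.fst ((φ.φV ω).pullback.map (ιc ≫ f.fS ⟨φ.base.vertexMap ω, hKV hωK⟩)) (s.fS ω) ≫
        (φ.φV ω).pullback.map ιc)
    (Fe : 𝒢'.E (𝒢'.graph.edgeOf β) ⥤ FintypeCat.{v₁}) [FiberFunctor Fe]
    (π : Fe.obj (pullback
      ((φ.φE (𝒢'.graph.edgeOf β) (𝒢.graph.edgeOf (φ.base.branchMap β))
          (φ.base.edgeOf_branchMap β).symm).pullback.map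
        (ιd ≫ f.fT ⟨𝒢.graph.edgeOf (φ.base.branchMap β), heH⟩))
      (s.fT (𝒢'.graph.edgeOf β) ≫
        (φ.reindexIso (𝒢'.graph.edgeOf β) (φ.base.edgeMap (𝒢'.graph.edgeOf β))
          (𝒢.graph.edgeOf (φ.base.branchMap β)) rfl (φ.base.edgeOf_branchMap β).symm).hom.app A))) :
    ∃ ϖ : Fe.obj (W.T ⟨𝒢'.graph.edgeOf β, hfK⟩),
      Fe.map (j.fT ⟨𝒢'.graph.edgeOf β, hfK⟩ ≫
        ((φ.restrict K H hKV hKE).reindexIso ⟨𝒢'.graph.edgeOf β, hfK⟩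
          ⟨𝒢.graph.edgeOf (φ.base.branchMap β), heH⟩ ⟨φ.base.edgeMap (𝒢'.graph.edgeOf β), hKE hfK⟩
          (Subtype.ext (φ.base.edgeOf_branchMap β).symm) rfl).inv.app Y) ϖ =
      Fe.map (pullback.fst _ _ ≫
        (φ.φE (𝒢'.graph.edgeOf β) (𝒢.graph.edgeOf (φ.base.branchMap β))
          (φ.base.edgeOf_branchMap β).symm).pullback.map ιd) π := by
  obtain ⟨ρ, hρ⟩ := φ.exists_point_pull_sectionFibre' A H T hTV hTE s β ω hβω (hKV hωK) heH Y f ιc ιd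
    k hk _ (φ.sectionE_transport A s β ω hβω) Fe π
  -- canonical names
  have hK : (𝒢'.restrict K).graph.abuts ⟨β, hfK⟩ = some (⟨ω, hωK⟩ : K.toSemiGraph.Vertex) :=
    (SemiGraph.Subgraph.abuts_eq_some_iff K _ _).mpr hβω
  let Φω : 𝒢.V (φ.base.vertexMap ω) ⥤ 𝒢'.V ω := (φ.φV ω).pullback
  let Φe : 𝒢.E (𝒢.graph.edgeOf (φ.base.branchMap β)) ⥤ 𝒢'.E (𝒢'.graph.edgeOf β) :=
    (φ.φE (𝒢'.graph.edgeOf β) (𝒢.graph.edgeOf (φ.base.branchMap β))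
      (φ.base.edgeOf_branchMap β).symm).pullback
  let Φr : 𝒢.E (φ.base.edgeMap (𝒢'.graph.edgeOf β)) ⥤ 𝒢'.E (𝒢'.graph.edgeOf β) :=
    (φ.φE (𝒢'.graph.edgeOf β) (φ.base.edgeMap (𝒢'.graph.edgeOf β)) rfl).pullback
  let B : 𝒢'.V ω ⥤ 𝒢'.E (𝒢'.graph.edgeOf β) := (𝒢'.pull β ω hβω).pullback
  let bY : 𝒢.V (φ.base.vertexMap ω) ⥤ 𝒢.E (𝒢.graph.edgeOf (φ.base.branchMap β)) :=
    (𝒢.pull (φ.base.branchMap β) (φ.base.vertexMap ω) (φ.base.abuts_branchMap β ω hβω)).pullback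
  let φBhY : B.obj (Φω.obj (Y.S ⟨φ.base.vertexMap ω, hKV hωK⟩)) ⟶
      Φe.obj (bY.obj (Y.S ⟨φ.base.vertexMap ω, hKV hωK⟩)) :=
    (φ.φB β ω hβω).hom.app (Y.S ⟨φ.base.vertexMap ω, hKV hωK⟩)
  let Yψh : bY.obj (Y.S ⟨φ.base.vertexMap ω, hKV hωK⟩) ⟶
      Y.T ⟨𝒢.graph.edgeOf (φ.base.branchMap β), heH⟩ :=
    (Y.ψ ⟨φ.base.branchMap β, heH⟩ ⟨φ.base.vertexMap ω, hKV hωK⟩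
      ((SemiGraph.Subgraph.abuts_eq_some_iff H _ _).mpr (φ.base.abuts_branchMap β ω hβω))).hom
  let RI := (φ.restrict K H hKV hKE).reindexIso ⟨𝒢'.graph.edgeOf β, hfK⟩
    ⟨𝒢.graph.edgeOf (φ.base.branchMap β), heH⟩ ⟨φ.base.edgeMap (𝒢'.graph.edgeOf β), hKE hfK⟩
    (Subtype.ext (φ.base.edgeOf_branchMap β).symm) rfl
  let RVY : Φe.obj (Y.T ⟨𝒢.graph.edgeOf (φ.base.branchMap β), heH⟩) ⟶
      Φr.obj (Y.T ⟨φ.base.edgeMap (𝒢'.graph.edgeOf β), hKE hfK⟩) := RI.hom.app Y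
  let RVYi : Φr.obj (Y.T ⟨φ.base.edgeMap (𝒢'.graph.edgeOf β), hKE hfK⟩) ⟶
      Φe.obj (Y.T ⟨𝒢.graph.edgeOf (φ.base.branchMap β), heH⟩) := RI.inv.app Y
  let WS : 𝒢'.V ω := W.S ⟨ω, hωK⟩
  let WT : 𝒢'.E (𝒢'.graph.edgeOf β) := W.T ⟨𝒢'.graph.edgeOf β, hfK⟩
  let jω : WS ⟶ Φω.obj (Y.S ⟨φ.base.vertexMap ω, hKV hωK⟩) := j.fS ⟨ω, hωK⟩
  let jf : WT ⟶ Φr.obj (Y.T ⟨φ.base.edgeMap (𝒢'.graph.edgeOf β), hKE hfK⟩) :=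
    j.fT ⟨𝒢'.graph.edgeOf β, hfK⟩
  let Wψh : B.obj WS ⟶ WT := (W.ψ ⟨β, hfK⟩ ⟨ω, hωK⟩ hK).hom
  let ac : pullback (Φω.map (ιc ≫ f.fS ⟨φ.base.vertexMap ω, hKV hωK⟩)) (s.fS ω) ⟶
      Φω.obj (Y.S ⟨φ.base.vertexMap ω, hKV hωK⟩) :=
    pullback.fst (Φω.map (ιc ≫ f.fS ⟨φ.base.vertexMap ω, hKV hωK⟩)) (s.fS ω) ≫ Φω.map ιc
  -- the gluing square of `j` at `β`, with the gluing of `ψ^* Y` unfolded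
  have hV : B.map jω ≫ φBhY ≫ Φe.map Yψh ≫ RVY = Wψh ≫ jf := j.comm ⟨β, hfK⟩ ⟨ω, hωK⟩ hK
  have hRi : RVY ≫ RVYi = 𝟙 _ := RI.hom_inv_id_app Y
  have e3 : B.map jω ≫ φBhY ≫ Φe.map Yψh = (B.map jω ≫ φBhY ≫ Φe.map Yψh ≫ RVY) ≫ RVYi := by
    simp only [Category.assoc, hRi, Category.comp_id]
  have hV' : B.map jω ≫ φBhY ≫ Φe.map Yψh = Wψh ≫ jf ≫ RVYi :=
    e3.trans ((congrArg (· ≫ RVYi) hV).trans (Category.assoc _ _ _))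
  have hac : ac = g ≫ jω := hg.symm
  refine ⟨Fe.map (B.map g ≫ Wψh) ρ, ?_⟩
  have hm : (B.map g ≫ Wψh) ≫ jf ≫ RVYi = B.map ac ≫ φBhY ≫ Φe.map Yψh :=
    calc (B.map g ≫ Wψh) ≫ jf ≫ RVYi = B.map g ≫ (Wψh ≫ jf ≫ RVYi) := Category.assoc _ _ _
      _ = B.map g ≫ (B.map jω ≫ φBhY ≫ Φe.map Yψh) := congrArg (B.map g ≫ ·) hV'.symm
      _ = (B.map g ≫ B.map jω) ≫ φBhY ≫ Φe.map Yψh := (Category.assoc _ _ _).symm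
      _ = B.map (g ≫ jω) ≫ φBhY ≫ Φe.map Yψh :=
          congrArg (· ≫ φBhY ≫ Φe.map Yψh) (B.map_comp g jω).symm
      _ = B.map ac ≫ φBhY ≫ Φe.map Yψh := by rw [hac]
  have h1 : Fe.map (jf ≫ RVYi) (Fe.map (B.map g ≫ Wψh) ρ) =
      Fe.map (B.map ac ≫ φBhY ≫ Φe.map Yψh) ρ := by
    have h := congrArg (fun m => Fe.map m ρ) hm
    simpa only [Functor.map_comp, FintypeCat.comp_apply] using h
  exact h1.trans hρ

/-! ### The branch step: edge ⇒ vertex -/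

/-- **Edge ⇒ vertex.**  In the same setting, with `c` CONNECTED and vertex alignment at the section
point of `ω` (`Stab(x_ω) ≤ ι_ω(Π_ω)` for the basepoint `β^* ⋙ F` of `𝒢′_ω`): if `W_{f′}` meets the
edge section fibre `Ψ_d` (a point `ϖ` of `F(W_{f′})` over a point `π` of `Ψ_d`), then the vertex section
fibre `Ψ_c → φ_ω^* Y_u` factors through `j_ω`.  (Part B along the gluing of `W`, then part A's lifting
lemma `exists_hom_sectionFibre_of_mem_range`.) [cite: MochizukiSemiAnbd2006, Cor. 2.7(i) p.30] -/
theorem Hom.sectionFibre_vertex_factors_of_edge_meets (φ : Hom 𝒢' 𝒢) (A : 𝒢.BObj)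
    (H : 𝒢.graph.Subgraph) (K : 𝒢'.graph.Subgraph)
    (hKV : K.verts ⊆ φ.base.vertexMap ⁻¹' H.verts) (hKE : K.edges ⊆ φ.base.edgeMap ⁻¹' H.edges)
    (T : 𝒢'.BObj) (hTV : ∀ v', IsTerminal (T.S v')) (hTE : ∀ e', IsTerminal (T.T e'))
    (s : T ⟶ φ.pullbackFunctor.obj A)
    (β : 𝒢'.graph.Branch) (ω : 𝒢'.graph.Vertex) (hβω : 𝒢'.graph.abuts β = some ω)
    (hωK : ω ∈ K.verts) (hfK : 𝒢'.graph.edgeOf β ∈ K.edges)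
    (heH : 𝒢.graph.edgeOf (φ.base.branchMap β) ∈ H.edges)
    (Y : (𝒢.restrict H).BObj) (f : Y ⟶ (𝒢.restrictFunctor H).obj A)
    {W : (𝒢'.restrict K).BObj} (j : W ⟶ (φ.restrict K H hKV hKE).pullbackFunctor.obj Y) [Mono j]
    {c : 𝒢.V (φ.base.vertexMap ω)} [PreGaloisCategory.IsConnected c]
    (ιc : c ⟶ Y.S ⟨φ.base.vertexMap ω, hKV hωK⟩)
    {d : 𝒢.E (𝒢.graph.edgeOf (φ.base.branchMap β))}
    (ιd : d ⟶ Y.T ⟨𝒢.graph.edgeOf (φ.base.branchMap β), heH⟩)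
    (k : d ⟶ (𝒢.pull (φ.base.branchMap β) (φ.base.vertexMap ω)
      (φ.base.abuts_branchMap β ω hβω)).pullback.obj c)
    (hk : k ≫ (𝒢.pull (φ.base.branchMap β) (φ.base.vertexMap ω)
        (φ.base.abuts_branchMap β ω hβω)).pullback.map ιc ≫
      (Y.ψ ⟨φ.base.branchMap β, heH⟩ ⟨φ.base.vertexMap ω, hKV hωK⟩
        ((SemiGraph.Subgraph.abuts_eq_some_iff H _ _).mpr (φ.base.abuts_branchMap β ω hβω))).hom = ιd)
    (Fe : 𝒢'.E (𝒢'.graph.edgeOf β) ⥤ FintypeCat.{v₁}) [FiberFunctor Fe]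
    (hVA : ∀ t : ((𝒢'.pull β ω hβω).pullback ⋙ Fe).obj (T.S ω),
      MulAction.stabilizer (Aut ((φ.φV ω).pullback ⋙ ((𝒢'.pull β ω hβω).pullback ⋙ Fe)))
          ((Iso.refl ((φ.φV ω).pullback ⋙ ((𝒢'.pull β ω hβω).pullback ⋙ Fe))).hom.app
            (A.S (φ.base.vertexMap ω)) (((𝒢'.pull β ω hβω).pullback ⋙ Fe).map (s.fS ω) t)) ≤
        ((Aut.autMulEquivOfIso (Iso.refl ((φ.φV ω).pullback ⋙ ((𝒢'.pull β ω hβω).pullback ⋙ Fe)))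
            ).toMonoidHom.comp (pi1Map (φ.φV ω).pullback ((𝒢'.pull β ω hβω).pullback ⋙ Fe))).range)
    (π : Fe.obj (pullback
      ((φ.φE (𝒢'.graph.edgeOf β) (𝒢.graph.edgeOf (φ.base.branchMap β))
          (φ.base.edgeOf_branchMap β).symm).pullback.map
        (ιd ≫ f.fT ⟨𝒢.graph.edgeOf (φ.base.branchMap β), heH⟩))
      (s.fT (𝒢'.graph.edgeOf β) ≫
        (φ.reindexIso (𝒢'.graph.edgeOf β) (φ.base.edgeMap (𝒢'.graph.edgeOf β))
          (𝒢.graph.edgeOf (φ.base.branchMap β)) rfl (φ.base.edgeOf_branchMap β).symm).hom.app A)))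
    (ϖ : Fe.obj (W.T ⟨𝒢'.graph.edgeOf β, hfK⟩))
    (hϖ : Fe.map (j.fT ⟨𝒢'.graph.edgeOf β, hfK⟩ ≫
        ((φ.restrict K H hKV hKE).reindexIso ⟨𝒢'.graph.edgeOf β, hfK⟩
          ⟨𝒢.graph.edgeOf (φ.base.branchMap β), heH⟩ ⟨φ.base.edgeMap (𝒢'.graph.edgeOf β), hKE hfK⟩
          (Subtype.ext (φ.base.edgeOf_branchMap β).symm) rfl).inv.app Y) ϖ =
      Fe.map (pullback.fst _ _ ≫
        (φ.φE (𝒢'.graph.edgeOf β) (𝒢.graph.edgeOf (φ.base.branchMap β))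
          (φ.base.edgeOf_branchMap β).symm).pullback.map ιd) π) :
    ∃ g : pullback ((φ.φV ω).pullback.map (ιc ≫ f.fS ⟨φ.base.vertexMap ω, hKV hωK⟩)) (s.fS ω) ⟶
        W.S ⟨ω, hωK⟩,
      g ≫ j.fS ⟨ω, hωK⟩ =
        pullback.fst ((φ.φV ω).pullback.map (ιc ≫ f.fS ⟨φ.base.vertexMap ω, hKV hωK⟩)) (s.fS ω) ≫
          (φ.φV ω).pullback.map ιc := by
  obtain ⟨ρ, hρ⟩ := φ.exists_point_pull_sectionFibre' A H T hTV hTE s β ω hβω (hKV hωK) heH Y f ιc ιd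
    k hk _ (φ.sectionE_transport A s β ω hβω) Fe π
  -- canonical names
  have hK : (𝒢'.restrict K).graph.abuts ⟨β, hfK⟩ = some (⟨ω, hωK⟩ : K.toSemiGraph.Vertex) :=
    (SemiGraph.Subgraph.abuts_eq_some_iff K _ _).mpr hβω
  let Φω : 𝒢.V (φ.base.vertexMap ω) ⥤ 𝒢'.V ω := (φ.φV ω).pullback
  haveI : PreservesFiniteLimits Φω := (φ.φV ω).property.1
  haveI : PreservesFiniteColimits Φω := (φ.φV ω).property.2
  let Φe : 𝒢.E (𝒢.graph.edgeOf (φ.base.branchMap β)) ⥤ 𝒢'.E (𝒢'.graph.edgeOf β) :=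
    (φ.φE (𝒢'.graph.edgeOf β) (𝒢.graph.edgeOf (φ.base.branchMap β))
      (φ.base.edgeOf_branchMap β).symm).pullback
  let Φr : 𝒢.E (φ.base.edgeMap (𝒢'.graph.edgeOf β)) ⥤ 𝒢'.E (𝒢'.graph.edgeOf β) :=
    (φ.φE (𝒢'.graph.edgeOf β) (φ.base.edgeMap (𝒢'.graph.edgeOf β)) rfl).pullback
  let B : 𝒢'.V ω ⥤ 𝒢'.E (𝒢'.graph.edgeOf β) := (𝒢'.pull β ω hβω).pullback
  haveI : PreservesFiniteLimits B := (𝒢'.pull β ω hβω).property.1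
  haveI : PreservesFiniteColimits B := (𝒢'.pull β ω hβω).property.2
  let Fb : 𝒢'.V ω ⥤ FintypeCat.{v₁} := B ⋙ Fe
  haveI : FiberFunctor Fb := fiberFunctor_comp_of_exact _ _
  let FC : 𝒢.V (φ.base.vertexMap ω) ⥤ FintypeCat.{v₁} := Φω ⋙ Fb
  haveI : FiberFunctor FC := fiberFunctor_comp_of_exact _ _
  let bY : 𝒢.V (φ.base.vertexMap ω) ⥤ 𝒢.E (𝒢.graph.edgeOf (φ.base.branchMap β)) :=
    (𝒢.pull (φ.base.branchMap β) (φ.base.vertexMap ω) (φ.base.abuts_branchMap β ω hβω)).pullback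
  let φBhY : B.obj (Φω.obj (Y.S ⟨φ.base.vertexMap ω, hKV hωK⟩)) ⟶
      Φe.obj (bY.obj (Y.S ⟨φ.base.vertexMap ω, hKV hωK⟩)) :=
    (φ.φB β ω hβω).hom.app (Y.S ⟨φ.base.vertexMap ω, hKV hωK⟩)
  let Yψh : bY.obj (Y.S ⟨φ.base.vertexMap ω, hKV hωK⟩) ⟶
      Y.T ⟨𝒢.graph.edgeOf (φ.base.branchMap β), heH⟩ :=
    (Y.ψ ⟨φ.base.branchMap β, heH⟩ ⟨φ.base.vertexMap ω, hKV hωK⟩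
      ((SemiGraph.Subgraph.abuts_eq_some_iff H _ _).mpr (φ.base.abuts_branchMap β ω hβω))).hom
  let RI := (φ.restrict K H hKV hKE).reindexIso ⟨𝒢'.graph.edgeOf β, hfK⟩
    ⟨𝒢.graph.edgeOf (φ.base.branchMap β), heH⟩ ⟨φ.base.edgeMap (𝒢'.graph.edgeOf β), hKE hfK⟩
    (Subtype.ext (φ.base.edgeOf_branchMap β).symm) rfl
  let RVY : Φe.obj (Y.T ⟨𝒢.graph.edgeOf (φ.base.branchMap β), heH⟩) ⟶
      Φr.obj (Y.T ⟨φ.base.edgeMap (𝒢'.graph.edgeOf β), hKE hfK⟩) := RI.hom.app Y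
  let RVYi : Φr.obj (Y.T ⟨φ.base.edgeMap (𝒢'.graph.edgeOf β), hKE hfK⟩) ⟶
      Φe.obj (Y.T ⟨𝒢.graph.edgeOf (φ.base.branchMap β), heH⟩) := RI.inv.app Y
  let WS : 𝒢'.V ω := W.S ⟨ω, hωK⟩
  let WT : 𝒢'.E (𝒢'.graph.edgeOf β) := W.T ⟨𝒢'.graph.edgeOf β, hfK⟩
  let jω : WS ⟶ Φω.obj (Y.S ⟨φ.base.vertexMap ω, hKV hωK⟩) := j.fS ⟨ω, hωK⟩
  let jf : WT ⟶ Φr.obj (Y.T ⟨φ.base.edgeMap (𝒢'.graph.edgeOf β), hKE hfK⟩) :=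
    j.fT ⟨𝒢'.graph.edgeOf β, hfK⟩
  let Wψh : B.obj WS ⟶ WT := (W.ψ ⟨β, hfK⟩ ⟨ω, hωK⟩ hK).hom
  let Wψi : WT ⟶ B.obj WS := (W.ψ ⟨β, hfK⟩ ⟨ω, hωK⟩ hK).inv
  let fu : Y.S ⟨φ.base.vertexMap ω, hKV hωK⟩ ⟶ A.S (φ.base.vertexMap ω) :=
    f.fS ⟨φ.base.vertexMap ω, hKV hωK⟩
  let sω : T.S ω ⟶ Φω.obj (A.S (φ.base.vertexMap ω)) := s.fS ω
  let ac : pullback (Φω.map (ιc ≫ fu)) sω ⟶ Φω.obj (Y.S ⟨φ.base.vertexMap ω, hKV hωK⟩) :=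
    pullback.fst (Φω.map (ιc ≫ fu)) sω ≫ Φω.map ιc
  haveI : @Mono (𝒢'.V ω) _ _ _ jω := (𝒢'.restrict K).mono_fS j ⟨ω, hωK⟩
  haveI : Subsingleton (Fb.obj (T.S ω)) := subsingleton_fiber_of_isTerminal Fb (hTV _)
  obtain ⟨tV⟩ := nonempty_fiber_of_isTerminal Fb (hTV ω)
  -- the gluing square of `j` at `β`
  have hV : B.map jω ≫ φBhY ≫ Φe.map Yψh ≫ RVY = Wψh ≫ jf := j.comm ⟨β, hfK⟩ ⟨ω, hωK⟩ hK
  have hRi : RVY ≫ RVYi = 𝟙 _ := RI.hom_inv_id_app Y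
  have hWi : Wψi ≫ Wψh = 𝟙 _ := (W.ψ ⟨β, hfK⟩ ⟨ω, hωK⟩ hK).inv_hom_id
  have e3 : (B.map jω ≫ φBhY ≫ Φe.map Yψh ≫ RVY) ≫ RVYi = B.map jω ≫ φBhY ≫ Φe.map Yψh := by
    simp only [Category.assoc, hRi, Category.comp_id]
  have e4 : Wψi ≫ (Wψh ≫ jf) ≫ RVYi = jf ≫ RVYi := by
    simp only [← Category.assoc, hWi, Category.id_comp]
  have hV' : Wψi ≫ B.map jω ≫ φBhY ≫ Φe.map Yψh = jf ≫ RVYi :=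
    (congrArg (Wψi ≫ ·) e3.symm).trans ((congrArg (fun m => Wψi ≫ m ≫ RVYi) hV).trans e4)
  -- the point of `β^* W_ω` under `ϖ`
  let ϖ' : Fb.obj (W.S ⟨ω, hωK⟩) := Fe.map Wψi ϖ
  have hs1 : Fe.map (Wψi ≫ B.map jω ≫ φBhY ≫ Φe.map Yψh) ϖ =
      Fe.map (Φe.map Yψh) (Fe.map φBhY (Fb.map jω ϖ')) := by
    simp only [Functor.map_comp, FintypeCat.comp_apply]
    rfl
  have h1 : Fe.map (Φe.map Yψh) (Fe.map φBhY (Fb.map jω ϖ')) = Fe.map (jf ≫ RVYi) ϖ :=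
    hs1.symm.trans (congrArg (fun m => Fe.map m ϖ) hV')
  have hs2 : Fe.map (B.map ac ≫ φBhY ≫ Φe.map Yψh) ρ =
      Fe.map (Φe.map Yψh) (Fe.map φBhY (Fb.map ac ρ)) := by
    simp only [Functor.map_comp, FintypeCat.comp_apply]
    rfl
  have h2 : Fe.map (Φe.map Yψh) (Fe.map φBhY (Fb.map ac ρ)) = Fe.map (jf ≫ RVYi) ϖ :=
    hs2.symm.trans (hρ.trans hϖ.symm)
  have hω : Fb.map jω ϖ' = Fb.map ac ρ :=
    map_iso_injective Fe ((φ.φB β ω hβω).app (Y.S ⟨φ.base.vertexMap ω, hKV hωK⟩))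
      (map_iso_injective Fe (Φe.mapIso (Y.ψ ⟨φ.base.branchMap β, heH⟩
        ⟨φ.base.vertexMap ω, hKV hωK⟩
        ((SemiGraph.Subgraph.abuts_eq_some_iff H _ _).mpr (φ.base.abuts_branchMap β ω hβω))))
        (h1.trans h2.symm))
  -- the two conditions of the lifting lemma
  have hωc : Fb.map jω ϖ' ∈ Set.range (Fb.map (Φω.map ιc)) := by
    rw [hω]
    exact ⟨Fb.map (pullback.fst (Φω.map (ιc ≫ fu)) sω) ρ, by
      rw [← FintypeCat.comp_apply, ← Fb.map_comp]⟩
  have hωx : Fb.map (Φω.map fu) (Fb.map jω ϖ') = Fb.map sω tV := by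
    rw [hω]
    change Fb.map (Φω.map fu) (Fb.map (pullback.fst (Φω.map (ιc ≫ fu)) sω ≫ Φω.map ιc) ρ) = _
    rw [← FintypeCat.comp_apply, ← Fb.map_comp, Category.assoc, ← Φω.map_comp, pullback.condition,
      Fb.map_comp, FintypeCat.comp_apply]
    congr 1
    exact Subsingleton.elim _ _
  obtain ⟨g, hg⟩ := exists_hom_sectionFibre_of_mem_range Φω Fb FC (Iso.refl _) ιc fu sω tV (hVA tV)
    jω ϖ' hωc hωx
  exact ⟨g, hg⟩

end SemiGraphOfAnabelioids

end Literature.AnabelianGeometry.SemiGraphs
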